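import Summits.AnomalousDissipation.AnomalousDissipation.Theses.QuarticLadder
import Summits.AnomalousDissipation.AnomalousDissipation.Theorems.UniformResolution.Negative.ResolutionCriterion
import Summits.AnomalousDissipation.AnomalousDissipation.Theorems.MomentParityUniformResolutionStubClosure
import Summits.AnomalousDissipation.AnomalousDissipation.Theorems.MomentParityUniformResolutionStubCylOfPoly
import Summits.AnomalousDissipation.AnomalousDissipation.Theorems.MomentParityUniformResolutionStubWeightedH2

/-!
# `QuarticLadder.UniformResolution` (stmt-AnomalousDissipation-14330), line `Sketch`:
# SUFFICIENCY of the bet — `LoudUI ⟹ UniformResolution`, the skeleton composed over its three landed stubs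

Support file of the line lead (prover-line-stmt-AnomalousDissipation-14330-c17-0; `--supports
stmt-AnomalousDissipation-14330`, registered sub-goal `uniformResolution_of_loudUI`; nothing here closes the item).

The line's skeleton (`Cruxes/UniformResolution/Lines/Sketch.lean`) closes the crux from four stubs; three are tree
theorems — S1 `MomentParityUniformResolution.stub_closure` (p89032, closure in the moment order), S2
`MomentParityUniformResolution.stub_cylOfPoly` (p87397, all-order polynomial rows ⇒ FMRT cylindrical rows), S3
`MomentParityUniformResolution.stub_weightedH2` (p162942, the Foias–Guillopé–Temam weighted `H²` bound) — and the
fourth, S4 `stub_loudUI` (loud invariant level families ⇒ `j`-uniform budgets and, at each `j`, a sequence of laws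
with UNIFORMLY INTEGRABLE enstrophy that is `N`-frequently a loud invariant level-`N` law in one ball), is the bet.
This file lands the composition with S4 as an explicit hypothesis:

* `uniformResolution_of_loudUI : LoudUI → QuarticLadder.UniformResolution` (hypothesis = the registered signature
  of `stub_loudUI`, universally closed, verbatim).

Together with the landed NECESSITY `MomentParityUniformResolution.resolved_implies_uniformlyIntegrable` (p89716:
the conclusion body of the crux at `ν > 0` is witnessed inside ONE family with uniformly integrable enstrophy) the
crux is certified, in tree, to have exactly the content "N-uniform integrability of the enstrophy of loud
Galerkin-invariant level laws at fixed viscosity" — the ensemble form of the mean energy EQUALITY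
`ν⟨‖∇u‖²⟩ = ⟨(f,u)⟩` for the loud Galerkin-limit stationary statistical solution (Foias–Manley–Rosa–Temam 2001,
Ch. IV (1.31) states the inequality only, `d = 3`). Composition: S1 level by level; the hypothesis; the subfamily
of loud invariant level laws among the `μs N`; S2 + S3 give `WeightedH2Bound 4`; the landed resolution criterion
`exists_isResolved_of_uniformlyIntegrable_of_weightedH2` gives ONE schedule `κ`.
-/

noncomputable section

-- `Summit.<Summit>.<Problem>` duplicate namespace is the tree's mandated layout for single-conjunct summits.
set_option linter.dupNamespace false

namespace Summit.AnomalousDissipation.AnomalousDissipation.Theorems.QuarticLadderUniformResolution.OfLoudUI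

open MeasureTheory Filter Topology
open scoped ENNReal
open Literature.Analysis.FunctionSpaces Literature.Analysis.FluidPDE
open Summit.AnomalousDissipation.AnomalousDissipation.Theorems.QuarticGate.Negative
open Summit.AnomalousDissipation.AnomalousDissipation.Theorems.UniformResolution.Negative

/-- Uniform integrability of the enstrophy passes to subfamilies. [folklore] -/
theorem uniformlyIntegrableEnstrophy_anti {𝓕 𝓖 : Set (Measure (Torus.energySpace (Fin 3)))} (h : 𝓖 ⊆ 𝓕)
    (hUI : UniformlyIntegrableEnstrophy 𝓕) : UniformlyIntegrableEnstrophy 𝓖 := fun η hη => by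
  obtain ⟨L, hL, hF⟩ := hUI η hη
  exact ⟨L, hL, fun μ hμ => hF μ (h hμ)⟩

/-- **`LoudUI ⟹ QuarticLadder.UniformResolution`** (registered sub-goal `uniformResolution_of_loudUI` of
stmt-AnomalousDissipation-14330; the hypothesis is the registered stub `stub_loudUI` of line `Sketch`, universally
closed). Fix `f, ν, E, ε` and the antecedent. At each `j` and each of its frequently-many levels S1 closes the
`d`-wise loud laws into a loud law stationary at every order; the hypothesis returns `j`-uniform budgets `(E′, ε′)`
and, at each `j`, a ball and a uniformly integrable sequence `μs` that is frequently a loud invariant level law; the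
subfamily of those members is uniformly integrable, Galerkin-stationary in the cylindrical sense by S2, hence carries
the weighted `H²` bound by S3, and the landed resolution criterion gives ONE schedule `κ` resolving all of it — the
conclusion body, the SAME law serving every order `d`. [folklore] -/
theorem uniformResolution_of_loudUI :
    (∀ (f : UnitAddTorus (Fin 3) → EuclideanSpace ℝ (Fin 3)), Literature.Analysis.FunctionSpaces.Torus.IsSmooth f → Literature.Analysis.FunctionSpaces.Torus.IsDivFree f → Literature.Analysis.FunctionSpaces.Torus.HasZeroMean f → ∀ (ν : ℕ → ℝ) (E ε : ℝ), (∀ j, 0 < ν j) → Filter.Tendsto ν Filter.atTop (nhds 0) → 0 < ε → (∀ j : ℕ, ∃ R : ℝ, ∃ᶠ N in Filter.atTop, ∃ μ : MeasureTheory.Measure (Literature.Analysis.FunctionSpaces.Torus.energySpace (Fin 3)), MeasureTheory.IsProbabilityMeasure μ ∧ (∀ᵐ u ∂μ, Summit.AnomalousDissipation.AnomalousDissipation.Theorems.QuarticGate.Negative.IsLevel N u) ∧ (∀ᵐ u ∂μ, ‖u‖ ≤ R) ∧ (∀ d : ℕ, Summit.AnomalousDissipation.AnomalousDissipation.Theorems.QuarticGate.Negative.IsPolyStationary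 (ν j) f N d μ) ∧ Literature.Analysis.FluidPDE.Torus.ensembleEnergy μ ≤ E ∧ ε ≤ Literature.Analysis.FluidPDE.Torus.ensembleDissipation (ν j) μ) → ∃ E' ε' : ℝ, 0 < ε' ∧ ∀ j : ℕ, ∃ (R : ℝ) (μs : ℕ → MeasureTheory.Measure (Literature.Analysis.FunctionSpaces.Torus.energySpace (Fin 3))), Summit.AnomalousDissipation.AnomalousDissipation.Theorems.UniformResolution.Negative.UniformlyIntegrableEnstrophy (Set.range μs) ∧ ∃ᶠ N in Filter.atTop, MeasureTheory.IsProbabilityMeasure (μs N) ∧ (∀ᵐ u ∂(μs N), Summit.AnomalousDissipation.AnomalousDissipation.Theorems.QuarticGate.Negative.IsLevel N u) ∧ (∀ᵐ u ∂(μs N), ‖u‖ ≤ R) ∧ (∀ d : ℕ, Summit.AnomalousDissipation.AnomalousDissipation.Theorems.QuarticGate.Negative.IsPolyStationary (ν j) f N d (μs N)) ∧ Literature.Analysis.FluidPDE.Torus.ensembleEnergy (μs N) ≤ E' ∧ ε' ≤ Literature.Analysis.FluidPDE.Torus.ensembleDissipation (ν j) (μs N)) → Summit.AnomalousDissipation.AnomalousDissipation.Theses.QuarticLadder.UniformResolution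 := by
  intro hLoudUI f hfs hfd hfz ν E ε hν hν0 hε hhyp
  -- S1: close the d-wise loud families in d, level by level
  have hinv : ∀ j : ℕ, ∃ R : ℝ, ∃ᶠ N in atTop, ∃ μ : Measure (Torus.energySpace (Fin 3)), IsProbabilityMeasure μ ∧
      (∀ᵐ u ∂μ, IsLevel N u) ∧ (∀ᵐ u ∂μ, ‖u‖ ≤ R) ∧ (∀ d : ℕ, IsPolyStationary (ν j) f N d μ) ∧
      Torus.ensembleEnergy μ ≤ E ∧ ε ≤ Torus.ensembleDissipation (ν j) μ := by
    intro j
    obtain ⟨R, hfreq⟩ := hhyp j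
    exact ⟨R, hfreq.mono fun N hN => MomentParityUniformResolution.stub_closure f hfs (ν j) N E ε R hN⟩
  -- the hypothesis (the bet S4)
  obtain ⟨E', ε', hε', hj⟩ := hLoudUI f hfs hfd hfz ν E ε hν hν0 hε hinv
  refine ⟨E', ε', hε', fun j => ?_⟩
  obtain ⟨R, μs, hUI, hfreq⟩ := hj j
  -- the subfamily of invariant level laws in the ball among the `μs N`
  set 𝓕 : Set (Measure (Torus.energySpace (Fin 3))) := {μ | μ ∈ Set.range μs ∧ IsProbabilityMeasure μ ∧ ∃ N : ℕ,
    (∀ᵐ u ∂μ, IsLevel N u) ∧ (∀ᵐ u ∂μ, ‖u‖ ≤ R) ∧ ∀ d : ℕ, IsPolyStationary (ν j) f N d μ} with h𝓕_def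
  have hUI' : UniformlyIntegrableEnstrophy 𝓕 := uniformlyIntegrableEnstrophy_anti (fun μ hμ => hμ.1) hUI
  -- S2 + S3: the weighted H² bound over 𝓕
  have hH2 : WeightedH2Bound 4 𝓕 := by
    refine MomentParityUniformResolution.stub_weightedH2 f hfs (ν j) (hν j) 𝓕 fun μ hμ => ?_
    obtain ⟨-, hp, N, hl, hb, hst⟩ := hμ
    haveI := hp
    exact ⟨hp, N, R, hl, hb, MomentParityUniformResolution.stub_cylOfPoly f hfs (ν j) N R μ hl hb hst⟩
  -- the landed resolution criterion
  obtain ⟨κ, hκ⟩ := exists_isResolved_of_uniformlyIntegrable_of_weightedH2 hUI' hH2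
  refine ⟨R, κ, hfreq.mono ?_⟩
  rintro N ⟨hp, hl, hb, hst, hE, hD⟩ d
  have hmem : μs N ∈ 𝓕 := ⟨Set.mem_range_self N, hp, N, hl, hb, hst⟩
  exact ⟨μs N, hp, hl, hb, hκ (μs N) hmem, hst d, hE, hD⟩

end Summit.AnomalousDissipation.AnomalousDissipation.Theorems.QuarticLadderUniformResolution.OfLoudUI

end
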